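import Summits.QuantumFields.YangMills.Theorems.UnitScaleTiltProp7PinnedKernelL1NoWrap
import Summits.QuantumFields.YangMills.Theorems.UnitScaleTiltProp7LinearCorrectorBoundFlat
import HarnessLib

/-!
# Route `UnitScaleTilt`, crux K1 «MinimiserStabilityRegPr» (stmt-QuantumFields-19200), route-R E′ path (α′) — S2-FLAT-CLOSE AND THE DOOR ROW AT `W = 1` WITHOUT THE TORUS-SIZE FLOOR: the same three
# theorems as ✓p671212 `Prop7CentreHarmonicRegaugeSupT3` (`exists_hInterp_const`, `sup_regauge_le_of_rows_T3`) and ✓p672075 `Prop7LinearCorrectorBoundFlat` (`hK_row_at_one`) with the binder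
# `40 ≤ sitesPerDir k` DELETED, over px22 g2's ✓p675878 `Prop7PinnedKernelL1NoWrap.exists_green_kernel_l1_le'` (near-field sums in the torus metric, ✓p672925 — wrap-free by construction)

Cell `ym3-torus`, D-0154 (3c) twin-width seat `ym-routeR-w3` (gen 6).  LOCATED GAP «SMALL-TORUS» (bus 2026-08-28T22:36Z): the flat (hK) of record ✓p669951 carried `40 ≤ sitesPerDir k` = `2·L^{m+n} ≥ 40` at the member,
absent for `L^{m+n} < 20` (the top levels of small-`m` families, every `K`); origin = no-wrap counting only; cure = px22's NOWRAP (✓p674772∕p675153∕p675878) threading this seat's ✓p672925 radial sums.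
This file re-cuts the three consumers; the primed theorems supersede the unprimed ones for every `(P, k)`.  THEOREMS ONLY (0 `def`, 0 `sorry`); `--supports stmt-QuantumFields-19200`, count-neutral.
YM₃ on T³ is a ladder rung (R3), not the Clay problem; nothing here claims the stub, the crux, d = 4 or the gap.

WHAT IS PROVED (ns `…Theorems.Prop7CentreHarmonicRegaugeSupT3NoWrap`).
* ★★ `exists_hInterp_const'` · ★★★ `sup_regauge_le_of_rows_T3'` (the flat LEMMA (S_H-SUP′) with one absolute `Φ`, hypotheses `d = 3`, `1 ≤ k ≤ m + K`, `c ≠ 0` ONLY) · ★★ `hK_row_at_one'` (✓p671456's door row (hK) at `U := 1`).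
HONEST SCOPE.  Verbatim re-cuts (proofs unchanged but for the supplier's name and the dropped binder).  Flat letters.

References: T. Bałaban, CMP 99 (1985) 75–102 [Balaban1985RegularSpaces] ((1.14) p.78, (1.36) p.82); CMP 95 (1984) 17–40 [Balaban1984PropagatorsI] ((1.4) p.18, (1.21) p.21);
CMP 102 (1985) 277–309 [Balaban1985Variational] (Prop. 7 p.299); CMP 99 (1985) 389–434 [Balaban1985BackgroundPropagators] ((3.8) p.392).
-/

set_option autoImplicit false

noncomputable section

open scoped BigOperators

namespace Summit.QuantumFields.YangMills.Theorems.Prop7CentreHarmonicRegaugeSupT3NoWrap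

open Literature.MathematicalPhysics.QuantumFieldTheory.Balaban1983to89
open LatticeFieldCalculus
open B9Eq39Adjoint (covD covDstar divB)
open B9TorusCalculus (torusT torusT_apply)
open B15DeterminingSets (embIter)
open Summit.QuantumFields.YangMills.Theorems.Prop7PinnedKernelL1NoWrap (exists_green_kernel_l1_le')
open Summit.QuantumFields.YangMills.Theorems.Prop7CentreHarmonicInterpKernel (norm_grad_interp_error_le)
open Summit.QuantumFields.YangMills.Theorems.Prop7CentreHarmonicRegaugeSup (sup_regauge_le_of_rows)
open Summit.QuantumFields.YangMills.Theorems.Prop7PinnedSupOfGradient (norm_le_of_vanish_centres_grad)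
open Summit.QuantumFields.YangMills.Theorems.Prop7LinearCorrectorBoundFlat (covD_one_eq_grad divB_one_eq_diverg covLaplace_one_eq_laplace)

/-! ## §1 The interpolation rows and LEMMA (S_H-SUP′), floor-free -/

/-- ★★ **`hInterp` (and `hInterp₀`) DISCHARGED ON THE FINEST TORUS**: there is an absolute `Φ` such that for every run `P` with `d = 3`, every `1 ≤ k ≤ m + K`, every lattice factor `c ≠ 0` (NO torus-size floor), every nontrivial real normed `V`, every `φ : Site P 0 → V` and every `φ_H` agreeing with `φ` on the k-centres and `Δ_c`-biharmonic off them, and every sup bound `s₁` of `Δ_cφ`: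
`‖∂_c(φ − φ_H)(b)‖ ≤ (Φ·L^k∕|c|)·s₁` at every bond and `‖(φ − φ_H)(y)‖ ≤ (d∕2)·L^k·(|c|⁻¹·((Φ·L^k∕|c|)·s₁))` at every site.
[cite: Balaban1985RegularSpaces, (1.36) p.82, (1.14) p.78; Balaban1984PropagatorsI, (1.4) p.18] -/
theorem exists_hInterp_const' : ∃ Φ : ℝ, ∀ (P : Params) (_ : P.d = 3) (k : ℕ) (_ : k ≤ P.m + P.K) (_ : 1 ≤ k) (c : ℝ) (_ : c ≠ 0)
    (V : Type) [NormedAddCommGroup V] [NormedSpace ℝ V] [Nontrivial V]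
    (φ φH : SiteField P 0 V), (∀ y ∈ Set.range (embIter (P := P) k), φH y = φ y) →
    (∀ z ∉ Set.range (embIter (P := P) k), laplace c (laplace c φH) z = 0) →
    ∀ (s₁ : ℝ), (∀ z, ‖laplace c φ z‖ ≤ s₁) →
      (∀ b : PBond P 0, ‖grad c (fun x => φ x - φH x) b‖ ≤ Φ * (P.L : ℝ) ^ k / |c| * s₁)
      ∧ (∀ y : Site P 0, ‖φ y - φH y‖ ≤ (P.d : ℝ) / 2 * (P.L : ℝ) ^ k * (|c|⁻¹ * (Φ * (P.L : ℝ) ^ k / |c| * s₁))) := by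
  obtain ⟨Φ, hΦ⟩ := exists_green_kernel_l1_le'
  refine ⟨Φ, ?_⟩
  intro P hd k hk hk1 c hc V _ _ _ φ φH hH hEL s₁ hs₁
  obtain ⟨G, hG0, hGrep, hK⟩ := hΦ P hd k hk hk1 c hc V
  have hI : ∀ b : PBond P 0, ‖grad c (fun x => φ x - φH x) b‖ ≤ Φ * (P.L : ℝ) ^ k / |c| * s₁ := fun b =>
    norm_grad_interp_error_le c (Set.range (embIter (P := P) k)) G hGrep hG0 φ φH hH hEL hs₁ b (hK b)
  refine ⟨hI, fun y => ?_⟩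
  have h0 : ∀ z : Site P k, (fun x => φ x - φH x) (embIter k z) = 0 := fun z => by
    simp only [hH (embIter k z) ⟨z, rfl⟩, sub_self]
  exact norm_le_of_vanish_centres_grad hk hc (fun x => φ x - φH x) h0 hI y

/-! ## §2 ★★★ LEMMA (S_H-SUP′), flat, with no displayed analytic row -/

/-- ★★★ **LEMMA (S_H-SUP′), FLAT, ON THE FINEST TORUS — `hInterp` NO LONGER DISPLAYED.**  There is an absolute `Φ` such that for every `P` with `d = 3`, `1 ≤ k ≤ m + K`, `c ≠ 0` (NO torus-size floor),
nontrivial real normed `V`: if `‖A(b)‖ ≤ s₀·(L^k)⁻¹` ((1.36)₁), `‖∂^*_cA(x)‖ ≤ s₁′·((L^k)²)⁻¹` (the divergence row), `Δ_cφ = ∂^*_cA`, and `φ_H` agrees with `φ` on `range (embIter k)` and is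
`Δ_c`-biharmonic off it, then `A_H := A − ∂_c(φ − φ_H)` satisfies (i) `‖A_H(b)‖ ≤ (s₀ + (Φ∕|c|)·s₁′)·(L^k)⁻¹`, (ii) `curl_c A_H = curl_c A`, (iii) `Δ_c(∂^*_cA_H)(x) = 0` off the centres
(`A_H ∈ S_H`), (iv) `φ − φ_H` vanishes at the centres, (v) `‖(φ − φ_H)(y)‖ ≤ (d·Φ∕(2·c²))·s₁′`.
[cite: Balaban1985RegularSpaces, (1.36) p.82, (1.14) p.78; Balaban1985Variational, Prop. 7 p.299; Balaban1984PropagatorsII, (2.8) p.224] -/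
theorem sup_regauge_le_of_rows_T3' : ∃ Φ : ℝ, ∀ (P : Params) (_ : P.d = 3) (k : ℕ) (_ : k ≤ P.m + P.K) (_ : 1 ≤ k) (c : ℝ) (_ : c ≠ 0)
    (V : Type) [NormedAddCommGroup V] [NormedSpace ℝ V] [Nontrivial V]
    (A : VecField P 0 V) (φ φH : SiteField P 0 V) (s₀ s₁' : ℝ),
    (∀ b, ‖A b‖ ≤ s₀ * ((P.L : ℝ) ^ k)⁻¹) →
    laplace c φ = diverg c A →
    (∀ y ∈ Set.range (embIter (P := P) k), φH y = φ y) →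
    (∀ z ∉ Set.range (embIter (P := P) k), laplace c (laplace c φH) z = 0) →
    (∀ x, ‖diverg c A x‖ ≤ s₁' * (((P.L : ℝ) ^ k) ^ 2)⁻¹) →
      (∀ b, ‖gaugeShift c (fun x => φ x - φH x) A b‖ ≤ (s₀ + Φ / |c| * s₁') * ((P.L : ℝ) ^ k)⁻¹)
      ∧ (∀ p, curl c (gaugeShift c (fun x => φ x - φH x) A) p = curl c A p)
      ∧ (∀ x ∉ Set.range (embIter (P := P) k), laplace c (diverg c (gaugeShift c (fun x => φ x - φH x) A)) x = 0)
      ∧ (∀ x ∈ Set.range (embIter (P := P) k), (fun x => φ x - φH x) x = 0)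
      ∧ (∀ y : Site P 0, ‖φ y - φH y‖ ≤ (P.d * Φ / (2 * c ^ 2)) * s₁') := by
  obtain ⟨Φ, hΦ⟩ := exists_hInterp_const'
  refine ⟨Φ, ?_⟩
  intro P hd k hk hk1 c hc V _ _ _ A φ φH s₀ s₁' hA hφ hH hEL hdiv
  have hℓ : (0 : ℝ) < (P.L : ℝ) ^ k := pow_pos (by exact_mod_cast P.L_pos) k
  have hℓne : (P.L : ℝ) ^ k ≠ 0 := hℓ.ne'
  have hca : |c| ≠ 0 := abs_ne_zero.mpr hc
  -- the sup bound of `Δ_cφ = ∂^*A`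
  have hs₁ : ∀ z, ‖laplace c φ z‖ ≤ s₁' * (((P.L : ℝ) ^ k) ^ 2)⁻¹ := fun z => by rw [hφ]; exact hdiv z
  obtain ⟨hI, hI₀⟩ := hΦ P hd k hk hk1 c hc V φ φH hH hEL _ hs₁
  -- `hInterp` in ✓p653652's currency with `c_I := Φ/|c|`, `ℓ := L^k`
  have hInterp : ∀ b : PBond P 0, ‖grad c (fun x => φ x - φH x) b‖ ≤ Φ / |c| * (P.L : ℝ) ^ k * (s₁' * (((P.L : ℝ) ^ k) ^ 2)⁻¹) := fun b => by
    have e : Φ * (P.L : ℝ) ^ k / |c| * (s₁' * (((P.L : ℝ) ^ k) ^ 2)⁻¹) = Φ / |c| * (P.L : ℝ) ^ k * (s₁' * (((P.L : ℝ) ^ k) ^ 2)⁻¹) := by ring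
    exact (hI b).trans_eq e
  obtain ⟨h1, h2, h3, h4⟩ := sup_regauge_le_of_rows c (Set.range (embIter (P := P) k)) A φ φH hℓ hA hφ hH hEL hInterp
  refine ⟨h1, h2, h3, h4, fun y => ?_⟩
  have e : (P.d : ℝ) / 2 * (P.L : ℝ) ^ k * (|c|⁻¹ * (Φ * (P.L : ℝ) ^ k / |c| * (s₁' * (((P.L : ℝ) ^ k) ^ 2)⁻¹))) = (P.d * Φ / (2 * c ^ 2)) * s₁' := by
    have e2 : c ^ 2 = |c| ^ 2 := (sq_abs c).symm
    rw [e2]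
    field_simp
  exact (hI₀ y).trans_eq e

/-! ## §2 The door's (hK) row at `W = 1`, floor-free -/

/-- ★★ **THE DOOR'S FIRST-ORDER ROW, INHABITED AT THE TRIVIAL BACKGROUND.**  There is an absolute `Φ` (✓p671212's) such that for every run `P` with `d = 3`, `1 ≤ k ≤ m + K` (NO torus-size floor),
every nontrivial real normed algebra `𝔸`, every site field `φ`, every `φ_H` agreeing with `φ` on `range (embIter k)` and covariantly biharmonic off it AT `U ≡ 1`, and every bond field `A` with
`Δ_1φ = D*_1A`: `‖D_{1,μ}(φ − φ_H)(x)‖ ≤ Φ·L^k·‖D*_1A‖_∞` at every `(μ, x)` — the hypothesis `hK` of ✓ `Prop7LinearCorrectorBound.linCorr_gauge_le_of_rows` at `U := 1`, `c_I := Φ`.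
[cite: Balaban1985RegularSpaces, (1.36) p.82; Balaban1985BackgroundPropagators, (3.8) p.392] -/
theorem hK_row_at_one' : ∃ Φ : ℝ, ∀ (P : Params) (_ : P.d = 3) (k : ℕ) (_ : k ≤ P.m + P.K) (_ : 1 ≤ k)
    (𝔸 : Type) [NormedRing 𝔸] [NormedAlgebra ℝ 𝔸] [Nontrivial 𝔸]
    (φ φH : Site P 0 → 𝔸), (∀ y ∈ Set.range (embIter (P := P) k), φH y = φ y) →
    (∀ z ∉ Set.range (embIter (P := P) k),
      divB (torusT P 0) (fun _ _ => (1 : 𝔸ˣ)) (fun μ => covD (torusT P 0) (fun _ _ => (1 : 𝔸ˣ)) μ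
        (fun y => divB (torusT P 0) (fun _ _ => (1 : 𝔸ˣ)) (fun ν => covD (torusT P 0) (fun _ _ => (1 : 𝔸ˣ)) ν φH) y)) z = 0) →
    ∀ (A : Fin P.d → Site P 0 → 𝔸),
    (∀ x, divB (torusT P 0) (fun _ _ => (1 : 𝔸ˣ)) (fun μ => covD (torusT P 0) (fun _ _ => (1 : 𝔸ˣ)) μ φ) x = divB (torusT P 0) (fun _ _ => (1 : 𝔸ˣ)) A x) →
    ∀ (μ : Fin P.d) (x : Site P 0),
      ‖covD (torusT P 0) (fun _ _ => (1 : 𝔸ˣ)) μ (fun y => φ y - φH y) x‖ ≤ Φ * (P.L : ℝ) ^ k * ‖(fun x => divB (torusT P 0) (fun _ _ => (1 : 𝔸ˣ)) A x)‖ := by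
  obtain ⟨Φ, hΦ⟩ := exists_hInterp_const'
  refine ⟨Φ, ?_⟩
  intro P hd k hk hk1 𝔸 _ _ _ φ φH hH hEL A hφ μ x
  -- the biharmonic row in flat letters
  have hEL' : ∀ z ∉ Set.range (embIter (P := P) k), laplace 1 (laplace 1 φH) z = 0 := by
    intro z hz
    have h := hEL z hz
    have e1 : (fun y => divB (torusT P 0) (fun _ _ => (1 : 𝔸ˣ)) (fun ν => covD (torusT P 0) (fun _ _ => (1 : 𝔸ˣ)) ν φH) y) = laplace 1 φH :=
      funext fun y => covLaplace_one_eq_laplace φH y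
    rw [e1, covLaplace_one_eq_laplace] at h
    exact h
  -- the sup bound of `Δ_1φ = D*_1A` in the `Pi` norm
  have hs₁ : ∀ z, ‖laplace 1 φ z‖ ≤ ‖(fun x => divB (torusT P 0) (fun _ _ => (1 : 𝔸ˣ)) A x)‖ := by
    intro z
    rw [← covLaplace_one_eq_laplace φ z, hφ z]
    exact norm_le_pi_norm (fun x => divB (torusT P 0) (fun _ _ => (1 : 𝔸ˣ)) A x) z
  obtain ⟨hI, -⟩ := hΦ P hd k hk hk1 1 one_ne_zero 𝔸 φ φH hH hEL' _ hs₁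
  have h := hI ⟨x, μ⟩
  rw [abs_one, div_one] at h
  rw [covD_one_eq_grad]
  exact h

end Summit.QuantumFields.YangMills.Theorems.Prop7CentreHarmonicRegaugeSupT3NoWrap

end
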